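import Mathlib
import HarnessLib
import Literature.Analysis.FluidPDE.AxisymHouLiVariables
import Literature.Analysis.FluidPDE.ClassicalSolution
import Summits.NavierStokesRegularity.NavierStokesRegularity.Theorems.UnthreadedDoorCapSymZonalToroidalInductionAlgebra
import Summits.NavierStokesRegularity.NavierStokesRegularity.Theorems.UnthreadedDoorCapSymZonalToroidalCommutations

/-!
# Route `UnthreadedDoor`, crux `PoloidalLiouville` (stmt-NavierStokesRegularity-1222), WALL W1 `stub_scalarLiouville` —
# crux idea «capsym-comparison» (ns-idea-13 g0), line input FL-C `CapSym.ZonalToroidalLiouville`: STEP (1), THE INDUCTION EQUATION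

KEY-NS #150 (2) / DIRECTOR-NS #246 (4), step (1) of the FL-C handoff plan (`FLC-HANDOFF.md`, evidence on 1222) ASSEMBLED from the
bricks `…CapSymZonalToroidalInductionAlgebra` (p652350) and `…CapSymZonalToroidalCommutations`: for `V, U` jointly smooth on
`]−∞,0[ × ℝ³`, `P(t,·) ∈ C¹`, `V(t,·)` divergence free and the potential-form equation
`(∂ₜU + ⟪V,∇U⟫ − ΔU)·x = ⟪V,x⟫ ∇U − ∇P` at every `t < 0`, the toroidal field `B(t) = ∇U(t) × x` solves the INDUCTION EQUATION
`∂ₜB + DB[V] − DV[B] = ΔB` pointwise on `]−∞,0[ × ℝ³`.  (The pressure-like `P(t,·)` is upgraded to `C²` from the equation itself: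
`∇P = ⟪V,x⟫∇U − (∂ₜU + ⟪V,∇U⟫ − ΔU)·x` is smooth.)

* `CapSym.contDiff_two_of_gradient_eq` — a `C¹` function whose gradient is a `C¹` field is `C²`;
* `CapSym.gradient_add₃` — `∇(f + g − h) = ∇f + ∇g − ∇h` at a point of differentiability;
* `CapSym.inductionEquation_of_potentialForm` — the induction equation.

WHAT THIS IS NOT: no NS-regularity statement is touched; FL-C is NOT proved here (remaining: step (4), the `ℝ⁵` lift of
`f = B_φ/ϖ` + `KNSSMaxPrincipleR5.eq_zero_of_abs_mul_le KNSS2009_lemma21_halfball_holds` — see `FLC-HANDOFF.md`);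
`PoloidalLiouville` (1222), its wall and the summit stay OPEN.  `--supports stmt-NavierStokesRegularity-1222 --as helper`.
[cite: KochNadirashviliSereginSverak2009, §5 Thm 5.2 (the equation for `ω_θ`)]
-/

noncomputable section

-- the summit and its single sub-problem share the name (CONVENTIONS §1)
set_option linter.dupNamespace false

open Set Function Filter Topology InnerProductSpace
open scoped RealInnerProductSpace ContDiff

namespace Summit.NavierStokesRegularity.NavierStokesRegularity.Theorems.PoloidalLiouville.CapSym

open Literature.Analysis Literature.Analysis.FluidPDE

/-- A differentiable `P : ℝ³ → ℝ` whose gradient is a `C¹` field is `C²`. [folklore] -/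
theorem contDiff_two_of_gradient_eq {P : EuclideanSpace ℝ (Fin 3) → ℝ} {G : EuclideanSpace ℝ (Fin 3) → EuclideanSpace ℝ (Fin 3)}
    (hP : Differentiable ℝ P) (hG : ContDiff ℝ 1 G) (h : ∀ y, gradient P y = G y) : ContDiff ℝ 2 P := by
  have hf : fderiv ℝ P = fun y => InnerProductSpace.toDual ℝ (EuclideanSpace ℝ (Fin 3)) (G y) := by
    funext y
    rw [← h y, gradient, LinearIsometryEquiv.apply_symm_apply]
  rw [show (2 : WithTop ℕ∞) = 1 + 1 from rfl, contDiff_succ_iff_fderiv]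
  refine ⟨hP, by simp, ?_⟩
  rw [hf]
  exact (InnerProductSpace.toDual ℝ (EuclideanSpace ℝ (Fin 3))).contDiff.comp hG

/-- `∇(f + g − h)(x) = ∇f(x) + ∇g(x) − ∇h(x)` at a point where `f, g, h` are differentiable. [folklore] -/
theorem gradient_add_sub {f g h : EuclideanSpace ℝ (Fin 3) → ℝ} {x : EuclideanSpace ℝ (Fin 3)}
    (hf : DifferentiableAt ℝ f x) (hg : DifferentiableAt ℝ g x) (hh : DifferentiableAt ℝ h x) :
    gradient (fun y => f y + g y - h y) x = gradient f x + gradient g x - gradient h x := by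
  have hfg : DifferentiableAt ℝ (fun y => f y + g y) x := hf.add hg
  simp only [gradient]
  rw [fderiv_fun_sub hfg hh, fderiv_fun_add hf hg, map_sub, map_add]

set_option maxHeartbeats 800000 in
/-- **Step (1) of FL-C: the induction equation for `B = ∇U × x` from the potential-form equation.**  Let `V, U` be jointly smooth
on `]−∞,0[ × ℝ³`, `P(t,·)` differentiable for `t < 0`, `div V(t,·) = 0`, and
`(∂ₜU + ⟪V,∇U⟫ − ΔU)(t,x)·x = ⟪V(t,x),x⟫ ∇U(t,x) − ∇P(t,x)` for all `t < 0`, `x`.  Then for all `t < 0`, `x`: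
`∂ₜB(t,x) + DB(t)(x)[V(t,x)] − DV(t)(x)[B(t,x)] = ΔB(t)(x)`, `B(t,y) = ∇U(t,y) × y`.
(`curl` of the potential form, the trace-free cofactor algebra, and the commutations `∂ₜ(∇U × x) = ∇(∂ₜU) × x`,
`Δ(∇U × x) = ∇(ΔU) × x`.) [cite: KochNadirashviliSereginSverak2009, §5 Thm 5.2] -/
theorem inductionEquation_of_potentialForm
    {V : ℝ → EuclideanSpace ℝ (Fin 3) → EuclideanSpace ℝ (Fin 3)} {U P : ℝ → EuclideanSpace ℝ (Fin 3) → ℝ}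
    (hV : ContDiffOn ℝ (⊤ : ℕ∞) (uncurry V) (Iio 0 ×ˢ univ))
    (hU : ContDiffOn ℝ (⊤ : ℕ∞) (uncurry U) (Iio 0 ×ˢ univ))
    (hP : ∀ t < 0, Differentiable ℝ (P t))
    (hdiv : ∀ t < 0, VectorCalculus.IsDivFree (V t))
    (heq : ∀ t < 0, ∀ x,
        (deriv (fun s => U s x) t + inner ℝ (V t x) (gradient (U t) x) - Laplacian.laplacian (U t) x) • x
          = (inner ℝ (V t x) x) • gradient (U t) x - gradient (P t) x) :
    ∀ t < 0, ∀ x : EuclideanSpace ℝ (Fin 3),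
      deriv (fun s => cross (gradient (U s) x) x) t
        + fderiv ℝ (fun y : EuclideanSpace ℝ (Fin 3) => cross (gradient (U t) y) y) x (V t x)
        - fderiv ℝ (V t) x (cross (gradient (U t) x) x)
        = Laplacian.laplacian (fun y : EuclideanSpace ℝ (Fin 3) => cross (gradient (U t) y) y) x := by
  intro t ht x
  have hU' : IsSmoothSpaceTimeOn (Iio 0) U := hU
  have hV' : IsSmoothSpaceTimeOn (Iio 0) V := hV
  -- slice regularity
  have hUs : ContDiff ℝ ∞ (U t) := hU'.contDiff_slice ht
  have hVs : ContDiff ℝ ∞ (V t) := hV'.contDiff_slice ht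
  -- the time derivative slice `∂ₜU(t,·)` is smooth
  have hUt : ContDiff ℝ ∞ (fun y : EuclideanSpace ℝ (Fin 3) => deriv (fun s => U s y) t) :=
    (hU'.isSmoothSpaceTimeOn_deriv isOpen_Iio).contDiff_slice ht
  have hU2 : ContDiff ℝ 2 (U t) := hUs.of_le (by norm_cast)
  have hU3 : ContDiff ℝ 3 (U t) := hUs.of_le (by norm_cast)
  have hgU : ContDiff ℝ ∞ (gradient (U t)) :=
    (InnerProductSpace.toDual ℝ (EuclideanSpace ℝ (Fin 3))).symm.contDiff.comp (hUs.fderiv_right (m := ∞) le_rfl)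
  have hLU : ContDiff ℝ ∞ (Laplacian.laplacian (U t)) := contDiff_laplacian_of_contDiff_infty hUs
  -- the three scalar functions
  set g₀ : EuclideanSpace ℝ (Fin 3) → ℝ := fun y => deriv (fun s => U s y) t with hg₀
  set gI : EuclideanSpace ℝ (Fin 3) → ℝ := fun y => ⟪V t y, gradient (U t) y⟫ with hgI
  set gL : EuclideanSpace ℝ (Fin 3) → ℝ := fun y => Laplacian.laplacian (U t) y with hgL
  set g₂ : EuclideanSpace ℝ (Fin 3) → ℝ := fun y => ⟪V t y, y⟫ with hg₂
  have hgIC : ContDiff ℝ ∞ gI := hVs.inner ℝ hgU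
  have hg₂C : ContDiff ℝ ∞ g₂ := hVs.inner ℝ contDiff_id
  have hg₁d : Differentiable ℝ (fun y => g₀ y + gI y - gL y) :=
    ((hUt.differentiable (by simp)).add (hgIC.differentiable (by simp))).sub (hLU.differentiable (by simp))
  have hg₂d : Differentiable ℝ g₂ := hg₂C.differentiable (by simp)
  -- the potential form, and `P(t,·) ∈ C²`
  have heq' : ∀ y : EuclideanSpace ℝ (Fin 3), (fun y => g₀ y + gI y - gL y) y • y = g₂ y • gradient (U t) y - gradient (P t) y :=
    fun y => heq t ht y
  have hP2 : ContDiff ℝ 2 (P t) := by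
    refine contDiff_two_of_gradient_eq (G := fun y => g₂ y • gradient (U t) y - (g₀ y + gI y - gL y) • y) (hP t ht) ?_ ?_
    · exact ((hg₂C.of_le (by norm_cast)).smul (hgU.of_le (by norm_cast))).sub
        ((((hUt.add hgIC).sub hLU).of_le (by norm_cast)).smul contDiff_id)
    · intro y
      have e := heq' y
      rw [eq_sub_iff_add_eq] at e
      rw [← e]
      simp
  -- curl of the potential form
  have hcurl := cross_gradient_eq_of_potentialForm hg₁d hg₂d hU2 hP2 heq' x
  rw [gradient_add_sub ((hUt.differentiable (by simp)) x) ((hgIC.differentiable (by simp)) x)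
    ((hLU.differentiable (by simp)) x)] at hcurl
  -- bilinearity of `cross` in the first slot
  have hlin : cross (gradient g₀ x + gradient gI x - gradient gL x) x =
      cross (gradient g₀ x) x + cross (gradient gI x) x - cross (gradient gL x) x := by
    rw [← crossCLM_apply, map_sub, map_add, _root_.sub_apply, _root_.add_apply]
    rfl
  rw [hlin] at hcurl
  -- the pieces
  have htr : ∑ m : Fin 3, fderiv ℝ (V t) x (EuclideanSpace.single m (1 : ℝ)) m = 0 := by
    have h := hdiv t ht x
    rw [divergence_eq_sum_three] at h
    simpa [Fin.sum_univ_three] using h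
  have halg := cross_gradient_inner_sub_eq ((hVs.differentiable (by simp)) x) htr hU2
  have hdt := deriv_cross_gradient_slice hU ht x
  have hlap := laplacian_cross_gradient hU3 x
  rw [hdt, hlap]
  -- assemble: `∇g₀ × x + ∇gI × x − ∇gL × x = ∇g₂ × ∇U`
  have egL : gradient (Laplacian.laplacian (U t)) x = gradient gL x := rfl
  have eg₀ : gradient (fun y : EuclideanSpace ℝ (Fin 3) => deriv (fun s => U s y) t) x = gradient g₀ x := rfl
  rw [egL, eg₀, add_sub_assoc, ← halg]
  have e2 : cross (gradient g₀ x) x =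
      cross (gradient g₂ x) (gradient (U t) x) - cross (gradient gI x) x + cross (gradient gL x) x := by
    rw [← hcurl]; abel
  rw [e2]
  abel

end Summit.NavierStokesRegularity.NavierStokesRegularity.Theorems.PoloidalLiouville.CapSym

end
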